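import Literature.MathematicalPhysics.QuantumFieldTheory.Balaban1983to89.B9Thm313WholeDir
import Literature.MathematicalPhysics.QuantumFieldTheory.Balaban1983to89.B9Thm313WholeInput

/-!
# `Balaban1983to89.B9Thm313WholeDirInput` — [B9] Theorem 3.13 (p. 426): the INPUT-HÖLDER MEMBERS (3.44)∕(3.45) of 𝔊 = 𝔓G₁ ON PRINT'S
# DIRECTION-PAIR FAMILY ∇_{U,ν}𝔊∇\*_{U,μ}, read from input Hölder norms on the G-lattice X and through the sliced X-probes (one member, one
# configuration; the theorems over the letters of `…B9Thm313WholeDir`)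

T. Bałaban, *Propagators for lattice gauge theories in a background field*, Commun. Math. Phys. **99** (1985) 389–434
[`Balaban1985BackgroundPropagators`, "B9"]; [4] = T. Bałaban, *Propagators and renormalization transformations for lattice
gauge theories. II*, Commun. Math. Phys. **96** (1984) 223–250 [`Balaban1984PropagatorsII`].

statement-level skeleton of published theorems with citation tags; proofs where landed; nothing here is a claim about the
Yang–Mills mass gap

THE PRINTED LOCI are those of `…B9Thm313WholeInput` and `…B9Thm313WholeDir` (verbatim there): (3.44)–(3.45) p. 398 (*"|(∇_UG(U)∇\*_Uλ)(x)| ≦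
B′₀(ε)e^{−δ₀d(y,y′)}(‖λ‖_ε + |λ|) … ‖ζ∇_UG(U)∇\*_Uλ‖_β ≦ …"*), (3.39)–(3.40) p. 397 (*"max_{μ,ν}"*, the Hölder quotients), Theorem 3.13 p. 426 and
(3.152)–(3.153), Theorem 3.12 p. 423, (3.130) p. 421, p. 398 (the scale-transfer remark); [4] (2.51)–(2.54) p. 232, Lemma 2.1 (2.60)–(2.61) p. 234.

WHY THIS FILE (successor work of the same seat; located point (O4′)).  `…B9Thm313WholeInput.GG_input44∕45_of_letters` type the input members of 𝔊
for the ONE-SLOT composite ∇_U𝔊∇\*_U (lattice Y, input norms `bHY ε` of Y-functions), which at the record's coordinate pins carries only the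
diagonal direction pairs.  THIS FILE types them PER DIRECTION PAIR, E = ∇_{U,ν} (or Φ^X_β∘∇_{U,ν}), F = ∇\*_{U,μ}, inputs on X (`bHX ε`), and packages
them over P × P in n06-k's family species (`familyOp`, `sliceProbe`, `hasMaj_familyOp'`) — the inputs `h44`∕`h45` of
`B9RWSums344InputFam.lines3445_of_hasMaj_fam` for 𝔊:
* ★ `GG_input_of_piecesF` — (3.153) with a left factor E and a GENERIC right factor F read from an input class (the F-abstraction of
  `…Input.GG_input_of_pieces`: the E-dependent pieces EG₁F, EG₁Dv, EG₁Q\* are hypotheses; RDv\*G₁F is a letter; QG₁F is built from Theorem 3.3's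
  (3.42)₃-type entry of G₀F (`he2F`) + the step + the domination + the local letter Q);
* ★ `GG_input44m_of_letters` ∕ ★ `GG_input45m_of_letters` — (3.44) ∕ (3.45) of ∇_{U,ν}𝔊∇\*_{U,μ} per pair (the twins of `GG_input44∕45_of_letters`:
  r1's right form `input44_of_step` ∕ `input45_of_step` twice with the direction letters, the per-direction left entry of G₁
  (`B9Thm312WholeLeft.entry1_of_stepD` from `Thm33G0Dir.e1d` ∕ `StepDir.sDd1`) resp. its Φ^X_β-probe (`B9Thm312WholeDir.probe43d_cNormR`), the
  ∇_νG₁Q\*-piece by `hasMaj_left_right(R)` from `Letters313DM.dgQsd ∕ pQd`, the letters `Letters313IM`, the scale transfer (2.60); constants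
  `constI44`, `constI45` of the sibling verbatim);
* ★ `GG_input44Family_of_letters` ∕ ★ `GG_input45Family_of_letters` — the packages over P × P (block maps `blk ∘ Prod.fst`, `blkPX ∘ Prod.fst`).

HONEST SCOPE.  Nothing of [B9] or [4] is asserted: Theorem 3.3 for G₀ per direction, the steps, the letters, the identities and (2.60)–(2.61) are
HYPOTHESES of printed ∕ definitional shape (located gap G-B9-16); the content is bookkeeping, kernel-checked.  NOT a node discharge, NOT summit
progress; count-neutral; one finite lattice at a time; nothing continuum, nothing about the mass gap.  Cell `pub-ymgap` (HUMAN RULING D-0062),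
Track A node N06 [B9], N06-ASSIGNMENT v1 row 21 (bundle F7), seat `pub-ymgap-dag-n06-l` (g6), 2026-08-27.
-/

namespace Literature.MathematicalPhysics.QuantumFieldTheory.Balaban1983to89.B9Thm313WholeDirInput

open Literature.MathematicalPhysics.QuantumFieldTheory.Balaban1983to89
open Finset B6RandomWalk B6RandomWalkHom B9Thm34Ext B9Thm37GlueCor36 B11SectG B9SectDSup
open B9Thm37AllNorms B9Thm37AllNormsInstances B9Thm312Whole B9Thm312WholeLeaf B9Thm312WholeLeft B9Thm313Whole B9Thm313WholeLeft
open B9RWSums343Holder B9Ineq347 B9Thm312WholeClasses B9Thm312WholeHolder B9Thm312WholeHHolder B9Thm313WholeHolder B9Thm313WholeInput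
open B9RWSums346SecondDiff B9RWSums344InputFam B9Thm312WholeDir B9Thm313WholeDir

noncomputable section

section OneMember

variable {g : B9.Geometry} {B : B9.Backgrounds} {X Y Z W PX PY P : Type}
variable [Fintype X] [Fintype Y] [Fintype Z] [Fintype W] [Fintype PX] [Fintype PY] [Fintype P] [Fintype g.Site]
variable {R₀ : ℝ} {H₀ : Prop}

/-! ## §1 (3.153) with a left factor and a generic right factor read from an input class -/

/-- ★ **(3.153) WITH A LEFT FACTOR E AND A GENERIC RIGHT FACTOR F READ FROM AN INPUT CLASS** `bA` of V-functions (dominating the block sup norm of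
`blkV`): E𝔊F = EG₁F − (EG₁Dv)(RDv\*G₁F) − (EG₁Q\*)(C₁QG₁F) (`E_GG_F_eq`), composed by `hasMaj_frakG_classes` with the classes bA → bC (output), `bP` (the
W-Hölder class of RDv\*G₁F), Z^{(1)} and 𝔠_Z^{(1)} for C₁ (`Letters313.c1_1`): the E-dependent pieces EG₁F (K₄₄), EG₁Dv (K_D), EG₁Q\* (K_Q, out of 𝔠_Z^{(1)})
at the common rate ρ₂ are hypotheses; QG₁F is built from the sup entry G₁F (`entry2_of_step` at the rate r: Theorem 3.3's (3.42)₃-type entry of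
G₀F `he2F` + the step on 𝔠⁽¹⁾), the domination `bA ≧ |·|` and the local letter Q (`q1`); provisos ρ₄ + 2σ ≦ ρ₂ ≦ r, ρ₂ + σ ≦ δ₃, r ≦ δ₀, r + σ ≦
δ_K, θc < 1 (the F-abstraction of `B9Thm313WholeInput.GG_input_of_pieces`, F = ∇\*_U there).
[cite: Balaban1985BackgroundPropagators, Thm 3.13 p.426 + (3.153) p.426 + (3.44)–(3.45) p.398 + (3.132) p.422; Balaban1984PropagatorsII, Lemma 2.1 (2.61) p.234] -/
theorem GG_input_of_piecesF (hG : GeoOK g) {𝔬 : Ops g B X Y Z W} {U : B.Cfg} {P' V : Type} [Fintype V]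
    {blkV : V → g.Site} {F : (V → ℝ) →ₗ[ℝ] (X → ℝ)}
    {bA : BlockNorm (toB6 g R₀ H₀) (V → ℝ)} {bP : BlockNorm (toB6 g R₀ H₀) (W → ℝ)} {bC : BlockNorm (toB6 g R₀ H₀) (P' → ℝ)}
    {E : (X → ℝ) →ₗ[ℝ] (P' → ℝ)} {θ B₀ B₃ Br K44 KD KQ δ₀ δ₃ δK r ρ₂ ρ₄ σ c : ℝ}
    (hrow : RowSum (toB6 g R₀ H₀) σ c) (hc : 0 ≤ c) (hθ : 0 ≤ θ) (hB₀ : 0 ≤ B₀) (hB₃ : 0 ≤ B₃) (hBr : 0 ≤ Br) (hK44 : 0 ≤ K44)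
    (hKD : 0 ≤ KD) (hKQ : 0 ≤ KQ) (hσ : 0 ≤ σ) (hρ₄ : 0 ≤ ρ₄) (hρ₄₂ : ρ₄ + 2 * σ ≤ ρ₂) (hρ₂r : ρ₂ ≤ r) (hρ₂₃ : ρ₂ + σ ≤ δ₃)
    (hr : 0 ≤ r) (hr0 : r ≤ δ₀) (hrK : r + σ ≤ δK) (hq : θ * c < 1)
    (hK1 : HasMaj (cNorm R₀ H₀ 𝔬.blk hG.lenle 1) (cNorm R₀ H₀ 𝔬.blk hG.lenle 1) (𝔬.G0 U ∘ₗ (𝔬.Tpi U + 𝔬.T2 U))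
      (fun a b => θ * Real.exp (-(δK * g.dist a b))))
    (he2F : HasMajorantHom (g := toB6 g R₀ H₀) blkV 𝔬.blk (𝔬.G0 U ∘ₗ F)
      (fun (a b : g.Site) => B₀ * g.len a * Real.exp (-(δ₀ * g.dist a b))))
    (hL : Letters313 𝔬 R₀ H₀ hG B₃ δ₃ U) (hI : Identities 𝔬 U)
    (hdom : ∀ (y : g.Site) (μ : V → ℝ), (BlockNorm.ofBlocks (toB6 g R₀ H₀) blkV).loc y μ ≤ bA.loc y μ)
    (hloc : ∀ (y : g.Site) (μ : V → ℝ), bA.IsLoc y μ → (BlockNorm.ofBlocks (toB6 g R₀ H₀) blkV).IsLoc y μ)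
    (hRG : HasMaj bA bP (𝔬.R U ∘ₗ 𝔬.Dvstar U ∘ₗ 𝔬.G1 U ∘ₗ F) (fun a b => Br * Real.exp (-(δ₃ * g.dist a b))))
    (hGop : HasMaj bA bC (E ∘ₗ (𝔬.G1 U ∘ₗ F)) (fun a b => K44 * Real.exp (-(ρ₂ * g.dist a b))))
    (hGD : HasMaj bP bC (E ∘ₗ (𝔬.G1 U ∘ₗ 𝔬.Dv U)) (fun a b => KD * Real.exp (-(ρ₂ * g.dist a b))))
    (hGQ : HasMaj (cNormR R₀ H₀ 𝔬.blkZ hG.lenle 1) bC (E ∘ₗ 𝔬.G1 U ∘ₗ 𝔬.Qstar U)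
      (fun a b => KQ * Real.exp (-(ρ₂ * g.dist a b)))) :
    HasMaj bA bC (E ∘ₗ (𝔬.GG U ∘ₗ F))
      (fun a b => (K44 + bP.κ * KD * Br * c + KQ * (B₃ * (B₃ * (B₀ * (1 - θ * c)⁻¹) * c) * c) * c) *
        Real.exp (-(ρ₄ * g.dist a b))) := by
  -- adapted from `B9Thm313WholeInput.GG_input_of_pieces` (∇\*_U ↦ F)
  have htri : Triangle254 (toB6 g R₀ H₀) := fun a b c => hG.tri a b c
  have hfix1 := fix_of_inverses hI.invG0' hI.invG1
  have hq1 : 0 ≤ (1 - θ * c)⁻¹ := inv_nonneg.mpr (by linarith)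
  have hA₁ : 0 ≤ B₀ * (1 - θ * c)⁻¹ := mul_nonneg hB₀ hq1
  have hρ₂0 : 0 ≤ ρ₂ := by linarith
  have hρ₂₃' : ρ₂ ≤ δ₃ := by linarith
  -- QG₁F : bA → Z^{(1)} — G₁F from the sup entry, the domination, the local letter Q
  have hm2 := entry2_of_step hG hrow hθ hB₀ hr hr0 hrK hK1 he2F hfix1 hq
  have h20 : HasMaj (BlockNorm.ofBlocks (toB6 g R₀ H₀) blkV) (BlockNorm.ofBlocks (toB6 g R₀ H₀) 𝔬.blk) (𝔬.G1 U ∘ₗ F)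
      (fun a b => B₀ * (1 - θ * c)⁻¹ * g.len a * Real.exp (-(r * g.dist a b))) :=
    hasMaj_of_hasMajorantHom (G := toB6 g R₀ H₀) blkV 𝔬.blk
      (fun a b => mul_nonneg (mul_nonneg hA₁ (hG.lenle a)) (Real.exp_nonneg _)) hm2
  have h2c : HasMaj (cNorm R₀ H₀ blkV hG.lenle 0) (cNorm R₀ H₀ 𝔬.blk hG.lenle 1) (𝔬.G1 U ∘ₗ F)
      (fun a b => B₀ * (1 - θ * c)⁻¹ * Real.exp (-(r * g.dist a b))) := by
    refine (hasMaj_cNorm_of_hasMaj hG 1 0 h20).mono fun y y' => le_of_eq ?_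
    have hy : g.len y ≠ 0 := (hG.lenpos y).ne'
    simp only [wt, pow_zero, pow_one, mul_one]
    rw [mul_assoc (B₀ * (1 - θ * c)⁻¹), mul_comm (g.len y), ← mul_assoc (B₀ * (1 - θ * c)⁻¹), mul_assoc,
      mul_inv_cancel₀ hy, mul_one]
  have h2o : HasMaj (BlockNorm.ofBlocks (toB6 g R₀ H₀) blkV) (cNorm R₀ H₀ 𝔬.blk hG.lenle 1) (𝔬.G1 U ∘ₗ F)
      (fun a b => B₀ * (1 - θ * c)⁻¹ * Real.exp (-(r * g.dist a b))) := by
    have h := hasMaj_toR_src hG h2c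
    simp only [Nat.cast_zero, neg_zero] at h
    exact hasMaj_of_in_zero h
  have h2A : HasMaj bA (cNorm R₀ H₀ 𝔬.blk hG.lenle 1) (𝔬.G1 U ∘ₗ F)
      (fun a b => B₀ * (1 - θ * c)⁻¹ * Real.exp (-(r * g.dist a b))) :=
    hasMaj_of_dom hdom hloc (fun a b => mul_nonneg hA₁ (Real.exp_nonneg _)) h2o
  have hQG : HasMaj bA (cNorm R₀ H₀ 𝔬.blkZ hG.lenle 1) (𝔬.Q U ∘ₗ (𝔬.G1 U ∘ₗ F))
      (fun a b => (cNorm R₀ H₀ 𝔬.blk hG.lenle 1 (X := X)).κ * B₃ * (B₀ * (1 - θ * c)⁻¹) * c *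
        Real.exp (-(ρ₂ * g.dist a b))) :=
    hasMaj_comp_exp htri hG.dnn hrow hB₃ hA₁ hρ₂0 hρ₂r hρ₂₃ hL.q1 h2A
  simp only [cNorm_κ, one_mul] at hQG
  -- C₁ : Z^{(1)} → 𝔠_Z^{(1)}
  have hC : HasMaj (cNorm R₀ H₀ 𝔬.blkZ hG.lenle 1) (cNormR R₀ H₀ 𝔬.blkZ hG.lenle 1) (𝔬.C1 U)
      (fun a b => B₃ * Real.exp (-(δ₃ * g.dist a b))) := hasMaj_len_tgt hG hL.c1_1
  have hBQ0 : 0 ≤ B₃ * (B₀ * (1 - θ * c)⁻¹) * c := mul_nonneg (mul_nonneg hB₃ hA₁) hc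
  -- (3.153) composed
  have hfr := hasMaj_frakG_classes htri hG.dnn hrow hK44 hKD hBr hKQ hB₃ hBQ0 hρ₄ hσ hρ₄₂ hGop hGD
    (hRG.of_rate_le hG.dnn hBr hρ₂₃') hGQ (hC.of_rate_le hG.dnn hB₃ hρ₂₃') hQG
  have hGG := hfr.congr (T' := E ∘ₗ (𝔬.GG U ∘ₗ F)) fun μ => by rw [E_GG_F_eq hI E F]
  refine hGG.mono fun a b => le_of_eq ?_
  simp only [cNorm_κ, cNormR_κ, one_mul, toB6_dist]

/-! ## §2 The two input-Hölder members of 𝔊 per direction pair, and the packages -/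

omit [Fintype P] in
/-- ★ **(3.44) FOR 𝔊 = 𝔓G₁ PER DIRECTION PAIR, PRINTED SHAPE** — ∇_{U,ν}𝔊∇\*_{U,μ} read from the input Hölder class `bHX ε` of X-functions into the block sup
norm of X: |(∇_{U,ν}𝔊∇\*_{U,μ}λ)(x)| ≦ K·e^{−ρ₄d(y,y′)}(‖λ‖_ε + |λ|) for x ∈ Δ(y), supp λ ⊂ Δ̃(y′), K = `constI44 θ θ_D θ_H θ_v B₀ B₃ B_i(ε) B_d(ε) B_r Λ κ_W c`
(the sibling's constant).  Route: (3.153) with E = ∇_{U,ν}, F = ∇\*_{U,μ} (`GG_input_of_piecesF`); ∇_νG₁∇\*_μ and ∇_νG₁Dv by r1's right form (`input44_of_step` ∕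
`input44_of_stepV` from Theorem 3.3's (3.44) per pair `Thm33G0Dir.h44m` ∕ the letter `Letters313IM.dgDvd`, the steps `StepDir.tDd1` ∕ `Letters313IM.tDv`,
the per-direction left entry ∇_{U,ν}G₁ of `B9Thm312WholeLeft.entry1_of_stepD` (`Thm33G0Dir.e1d`, `StepDir.sDd1`) transferred by (2.60)); ∇_νG₁Q\* by
`hasMaj_left_right` (letters `Letters313DM.dgQsd`, `gQs2`) transferred by (2.60) to Z^{(1)} → 𝔠^{(0)}.  Provisos: ρ₄ + 3σ ≦ (1 − α)r, r ≦ δ₀, r ≦ δ₃,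
r + σ ≦ δ_K, θc < 1 — the per-pair twin of `B9Thm313WholeInput.GG_input44_of_letters`.
[cite: Balaban1985BackgroundPropagators, Thm 3.13 p.426 + (3.153) p.426 + (3.44) p.398 + (3.39) p.397 + Thm 3.12 p.423 + p.398 (remark after (3.47)); Balaban1984PropagatorsII, Lemma 2.1 (2.60)–(2.61) p.234] -/
theorem GG_input44m_of_letters (hG : GeoOK g) (𝔭 : HolderProbes g B X Y PX PY) {𝔬 : Ops g B X Y Z W} {U : B.Cfg}
    {Dd Dds : B.Cfg → P → Module.End ℝ (X → ℝ)}
    {bHX : ℝ → BlockNorm (toB6 g R₀ H₀) (X → ℝ)} {bHW : ℝ → BlockNorm (toB6 g R₀ H₀) (W → ℝ)} {bH : BlockNorm (toB6 g R₀ H₀) (W → ℝ)}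
    {Bh Bi Bq Bd : ℝ → ℝ} {Bi2 Bd2 : ℝ → ℝ → ℝ} {θ θD θH θv B₀ B₃ Br δ₀ δ₃ δK r ρ₄ α Λ σ c ε : ℝ} (hrow : RowSum (toB6 g R₀ H₀) σ c)
    (hc : 0 ≤ c) (hθ : 0 ≤ θ) (hθD : 0 ≤ θD) (hθH : 0 ≤ θH) (hθv : 0 ≤ θv) (hB₀ : 0 ≤ B₀) (hB₃ : 0 ≤ B₃) (hBi : 0 ≤ Bi ε)
    (hBd : 0 ≤ Bd ε) (hBr : 0 ≤ Br) (hΛ : 0 ≤ Λ) (hα : 0 ≤ α) (hσ : 0 ≤ σ) (hε0 : 0 < ε) (hε1 : ε ≤ 1) (hρ₄ : 0 ≤ ρ₄)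
    (hρ₄r : ρ₄ + 3 * σ ≤ (1 - α) * r) (hr : 0 ≤ r) (hr0 : r ≤ δ₀) (hr₃ : r ≤ δ₃) (hrK : r + σ ≤ δK) (hq : θ * c < 1)
    (hST : ScaleTransfer g r α Λ (fun y => g.len y ^ (1 : ℝ)))
    (hK1 : HasMaj (cNorm R₀ H₀ 𝔬.blk hG.lenle 1) (cNorm R₀ H₀ 𝔬.blk hG.lenle 1) (𝔬.G0 U ∘ₗ (𝔬.Tpi U + 𝔬.T2 U))
      (fun a b => θ * Real.exp (-(δK * g.dist a b))))
    (hK2 : HasMaj (cNorm R₀ H₀ 𝔬.blk hG.lenle 2) (cNorm R₀ H₀ 𝔬.blk hG.lenle 2) (𝔬.G0 U ∘ₗ (𝔬.Tpi U + 𝔬.T2 U))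
      (fun a b => θ * Real.exp (-(δK * g.dist a b))))
    (he0 : HasMajorant (g := toB6 g R₀ H₀) 𝔬.blk (𝔬.G0 U) (fun a b => B₀ * g.len a ^ 2 * Real.exp (-(δ₀ * g.dist a b))))
    (hH0 : Thm33G0Dir 𝔬 𝔭 Dd Dds R₀ H₀ bHX B₀ Bh Bi Bi2 δ₀ U) (hHR : Thm33G0DirR 𝔬 Dds R₀ H₀ B₀ δ₀ U)
    (hSD : StepDir 𝔬 𝔭 Dd Dds R₀ H₀ bHX hG.lenle θD θH δK U)
    (hL : Letters313 𝔬 R₀ H₀ hG B₃ δ₃ U) (hLDM : Letters313DM 𝔬 𝔭 Dd R₀ H₀ hG B₃ Bq δ₃ bH U)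
    (hLIM : Letters313IM 𝔬 𝔭 Dd Dds R₀ H₀ hG.lenle bHX bHW Br θv Bd Bd2 δ₃ δK U) (hI : Identities 𝔬 U) (ν μ : P) :
    HasMaj (bHX ε) (BlockNorm.ofBlocks (toB6 g R₀ H₀) 𝔬.blk) (Dd U ν ∘ₗ (𝔬.GG U ∘ₗ Dds U μ))
      (fun (a b : g.Site) => constI44 θ θD θH θv B₀ B₃ (Bi ε) (Bd ε) Br Λ (bHW ε).κ c * Real.exp (-(ρ₄ * g.dist a b))) := by
  -- adapted from `B9Thm313WholeInput.GG_input44_of_letters` (direction letters, X-inputs)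
  have hfix1 := fix_of_inverses hI.invG0' hI.invG1
  have hfixR := fix_right_of_inverses hI.invG0' hI.invG1
  have hq1 : 0 ≤ (1 - θ * c)⁻¹ := inv_nonneg.mpr (by linarith)
  have hA₁ : 0 ≤ B₀ * (1 - θ * c)⁻¹ := mul_nonneg hB₀ hq1
  have hA₃ : 0 ≤ B₃ * (1 - θ * c)⁻¹ := mul_nonneg hB₃ hq1
  have hCL : 0 ≤ B₀ + θD * (B₀ * (1 - θ * c)⁻¹) * c := add_nonneg hB₀ (mul_nonneg (mul_nonneg hθD hA₁) hc)
  have hKQ' : 0 ≤ B₃ + θD * (B₃ * (1 - θ * c)⁻¹) * c := add_nonneg hB₃ (mul_nonneg (mul_nonneg hθD hA₃) hc)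
  -- rates
  have h1α : (1 - α) * r ≤ r := by rw [sub_mul, one_mul]; exact sub_le_self _ (mul_nonneg hα hr)
  have hρ₂0 : 0 ≤ ρ₄ + 2 * σ := by linarith
  have hρ₂σ : ρ₄ + 2 * σ + σ ≤ (1 - α) * r := by linarith
  have hρ₂α : ρ₄ + 2 * σ ≤ (1 - α) * r := by linarith
  have hρ₂r : ρ₄ + 2 * σ ≤ r := by linarith
  have hρ₂K : ρ₄ + 2 * σ ≤ δK := by linarith
  have hρ₂0' : ρ₄ + 2 * σ ≤ δ₀ := by linarith
  have hρ₂₃ : ρ₄ + 2 * σ ≤ δ₃ := by linarith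
  have hρ₂₃σ : ρ₄ + 2 * σ + σ ≤ δ₃ := by linarith
  -- the per-direction left entry ∇_{U,ν}G₁ at the rate r
  have hm1 := entry1_of_stepD hG hrow hθ hθD hB₀ hr hr0 hrK hK2 (hSD.sDd1 ν) he0 (hH0.e1d ν) hfix1 hq
  -- ∇_νG₁∇*_μ from `bHX ε` and ∇_νG₁Dv from `bHW ε` by the right form
  have hGop := input44_of_step hG hrow hθH hBi hCL hΛ hρ₂0 hρ₂σ hρ₂K hρ₂0' hST hm1 (hH0.h44m (ν, μ) ε hε0 hε1)
    (hSD.tDd1 μ ε hε0) hfixR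
  have hGD := input44_of_stepV hG hrow hθv hBd hCL hΛ hρ₂0 hρ₂σ hρ₂K hρ₂₃ hST hm1 (hLIM.dgDvd ν ε hε0 hε1) (hLIM.tDv ε hε0)
    hfixR
  -- ∇_νG₁Q* : Z⁰ → 𝔠⁽¹⁾ by the left form, then (2.60): Z^{(1)} → 𝔠^{(0)}
  have hGQr := hasMaj_right_of_step hG hrow hθ hB₃ hr hr₃ hrK hK2 hL.gQs2 hfix1 hq
  have hDQ := hasMaj_left_right hG hrow hθD hB₃ hA₃ hr hr₃ le_rfl hrK (hSD.sDd1 ν) (hLDM.dgQsd ν) hGQr hfix1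
  have hDQR : HasMaj (cNormR R₀ H₀ 𝔬.blkZ hG.lenle 0) (cNormR R₀ H₀ 𝔬.blk hG.lenle (-1)) (Dd U ν ∘ₗ 𝔬.G1 U ∘ₗ 𝔬.Qstar U)
      (fun y y' => (B₃ + θD * (B₃ * (1 - θ * c)⁻¹) * c) * Real.exp (-(r * g.dist y y'))) := by
    have h := hasMaj_toR hG hDQ
    simp only [Nat.cast_zero, neg_zero, Nat.cast_one] at h
    exact h
  have hDQT := hasMaj_transfer hG hKQ' hST hDQR
  have e1 : (0 : ℝ) + 1 = 1 := by ring
  have e2 : (-1 : ℝ) + 1 = 0 := by ring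
  rw [e1, e2] at hDQT
  have hGQ : HasMaj (cNormR R₀ H₀ 𝔬.blkZ hG.lenle 1) (BlockNorm.ofBlocks (toB6 g R₀ H₀) 𝔬.blk) (Dd U ν ∘ₗ 𝔬.G1 U ∘ₗ 𝔬.Qstar U)
      (fun a b => (B₃ + θD * (B₃ * (1 - θ * c)⁻¹) * c) * Λ * Real.exp (-((ρ₄ + 2 * σ) * g.dist a b))) :=
    hasMaj_of_out_zero (hDQT.of_rate_le hG.dnn (mul_nonneg hKQ' hΛ) hρ₂α)
  -- (3.153)
  have h := GG_input_of_piecesF hG hrow hc hθ hB₀ hB₃ hBr (add_nonneg hBi (mul_nonneg (mul_nonneg (mul_nonneg hCL hΛ) hθH) hc))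
    (add_nonneg hBd (mul_nonneg (mul_nonneg (mul_nonneg hCL hΛ) hθv) hc)) (mul_nonneg hKQ' hΛ) hσ hρ₄ le_rfl hρ₂r hρ₂₃σ hr hr0 hrK hq
    hK1 (hHR.e2d μ) hL hI (hLIM.domX ε hε0) (hLIM.locX ε hε0) (hLIM.rgdd μ ε hε0) hGop hGD hGQ
  refine h.mono fun a b => le_of_eq ?_
  simp only [constI44]

omit [Fintype P] in
/-- ★ **(3.45) FOR 𝔊 = 𝔓G₁ PER DIRECTION PAIR, PRINTED SHAPE** — Φ^X_β∘∇_{U,ν}𝔊∇\*_{U,μ} read from the input Hölder class `bHX (β+ε)` into the probe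
blocks of X: ‖ζ∇_{U,ν}𝔊∇\*_{U,μ}λ‖_β-type bound K·(Lʲη)^{−β}·e^{−ρ₄d(y,y′)}(‖λ‖_{β+ε} + |λ|), K = `constI45 θ θ_H θ_v B₀ B₃ B_h B_i2 B_d2 B_q B_r Λ κ_W c`
(the sibling's constant).  Route: (3.153) with E = Φ^X_β∘∇_{U,ν} in the real class 𝔠_P^{(β)} (`GG_input_of_piecesF`); Φ^X_β∇_νG₁∇\*_μ and Φ^X_β∇_νG₁Dv
by the right form (`input45_of_step` from Theorem 3.3's (3.45) per pair `Thm33G0Dir.h45m` ∕ the letter `Letters313IM.pdgDvd`, the steps `StepDir.tDd1` ∕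
`Letters313IM.tDv`, the probe entry `B9Thm312WholeDir.probe43d_cNormR` from `Thm33G0Dir.h43d` ∕ `StepDir.pXd1`); Φ^X_β∇_νG₁Q\* by `hasMaj_left_rightR`
(letters `Letters313DM.pQd`, `gQs2`, the probe step `pXd1`) transferred by (2.60).  Provisos as for (3.44) — the per-pair twin of
`B9Thm313WholeInput.GG_input45_of_letters`.
[cite: Balaban1985BackgroundPropagators, Thm 3.13 p.426 + (3.153) p.426 + (3.45) p.398 + (3.39)–(3.40) p.397 + Thm 3.12 p.423 + p.398 (remark after (3.47)); Balaban1984PropagatorsII, Lemma 2.1 (2.60)–(2.61) p.234] -/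
theorem GG_input45m_of_letters (hG : GeoOK g) (𝔭 : HolderProbes g B X Y PX PY) {𝔬 : Ops g B X Y Z W} {U : B.Cfg}
    {Dd Dds : B.Cfg → P → Module.End ℝ (X → ℝ)}
    {bHX : ℝ → BlockNorm (toB6 g R₀ H₀) (X → ℝ)} {bHW : ℝ → BlockNorm (toB6 g R₀ H₀) (W → ℝ)} {bH : BlockNorm (toB6 g R₀ H₀) (W → ℝ)}
    {Bh Bi Bq Bd : ℝ → ℝ} {Bi2 Bd2 : ℝ → ℝ → ℝ} {θ θD θH θv B₀ B₃ Br β δ₀ δ₃ δK r ρ₄ α Λ σ c ε : ℝ}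
    (hrow : RowSum (toB6 g R₀ H₀) σ c)
    (hc : 0 ≤ c) (hθ : 0 ≤ θ) (hθH : 0 ≤ θH) (hθv : 0 ≤ θv) (hB₀ : 0 ≤ B₀) (hB₃ : 0 ≤ B₃) (hBh : 0 ≤ Bh β) (hBi2 : 0 ≤ Bi2 ε β)
    (hBq : 0 ≤ Bq β) (hBd2 : 0 ≤ Bd2 ε β) (hBr : 0 ≤ Br) (hΛ : 0 ≤ Λ) (hα : 0 ≤ α) (hσ : 0 ≤ σ) (hε0 : 0 < ε) (hε1 : ε ≤ 1)
    (hβ0 : 0 ≤ β) (hβ1 : β < 1) (hρ₄ : 0 ≤ ρ₄) (hρ₄r : ρ₄ + 3 * σ ≤ (1 - α) * r) (hr : 0 ≤ r) (hr0 : r ≤ δ₀) (hr₃ : r ≤ δ₃)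
    (hrK : r + σ ≤ δK) (hq : θ * c < 1) (hST : ScaleTransfer g r α Λ (fun y => g.len y ^ (1 : ℝ)))
    (hK1 : HasMaj (cNorm R₀ H₀ 𝔬.blk hG.lenle 1) (cNorm R₀ H₀ 𝔬.blk hG.lenle 1) (𝔬.G0 U ∘ₗ (𝔬.Tpi U + 𝔬.T2 U))
      (fun a b => θ * Real.exp (-(δK * g.dist a b))))
    (hK2 : HasMaj (cNorm R₀ H₀ 𝔬.blk hG.lenle 2) (cNorm R₀ H₀ 𝔬.blk hG.lenle 2) (𝔬.G0 U ∘ₗ (𝔬.Tpi U + 𝔬.T2 U))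
      (fun a b => θ * Real.exp (-(δK * g.dist a b))))
    (he0 : HasMajorant (g := toB6 g R₀ H₀) 𝔬.blk (𝔬.G0 U) (fun a b => B₀ * g.len a ^ 2 * Real.exp (-(δ₀ * g.dist a b))))
    (hH0 : Thm33G0Dir 𝔬 𝔭 Dd Dds R₀ H₀ bHX B₀ Bh Bi Bi2 δ₀ U) (hHR : Thm33G0DirR 𝔬 Dds R₀ H₀ B₀ δ₀ U)
    (hSD : StepDir 𝔬 𝔭 Dd Dds R₀ H₀ bHX hG.lenle θD θH δK U)
    (hL : Letters313 𝔬 R₀ H₀ hG B₃ δ₃ U) (hLDM : Letters313DM 𝔬 𝔭 Dd R₀ H₀ hG B₃ Bq δ₃ bH U)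
    (hLIM : Letters313IM 𝔬 𝔭 Dd Dds R₀ H₀ hG.lenle bHX bHW Br θv Bd Bd2 δ₃ δK U) (hI : Identities 𝔬 U) (ν μ : P) :
    HasMaj (bHX (β + ε)) (BlockNorm.ofBlocks (toB6 g R₀ H₀) 𝔭.blkPX) ((𝔭.ΦX U β ∘ₗ Dd U ν) ∘ₗ (𝔬.GG U ∘ₗ Dds U μ))
      (fun (a b : g.Site) => constI45 θ θH θv B₀ B₃ (Bh β) (Bi2 ε β) (Bd2 ε β) (Bq β) Br Λ (bHW (β + ε)).κ c * g.len a ^ (-β) *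
        Real.exp (-(ρ₄ * g.dist a b))) := by
  -- adapted from `B9Thm313WholeInput.GG_input45_of_letters` (direction letters, X-inputs, X-probes)
  have htri : Triangle254 (toB6 g R₀ H₀) := fun a b c => hG.tri a b c
  have hfix1 := fix_of_inverses hI.invG0' hI.invG1
  have hfixR := fix_right_of_inverses hI.invG0' hI.invG1
  have hq1 : 0 ≤ (1 - θ * c)⁻¹ := inv_nonneg.mpr (by linarith)
  have hA₁ : 0 ≤ B₀ * (1 - θ * c)⁻¹ := mul_nonneg hB₀ hq1
  have hA₃ : 0 ≤ B₃ * (1 - θ * c)⁻¹ := mul_nonneg hB₃ hq1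
  have hCh : 0 ≤ Bh β + θH * (B₀ * (1 - θ * c)⁻¹) * c := add_nonneg hBh (mul_nonneg (mul_nonneg hθH hA₁) hc)
  have hKQ' : 0 ≤ Bq β + θH * (B₃ * (1 - θ * c)⁻¹) * c := add_nonneg hBq (mul_nonneg (mul_nonneg hθH hA₃) hc)
  -- rates
  have h1α : (1 - α) * r ≤ r := by rw [sub_mul, one_mul]; exact sub_le_self _ (mul_nonneg hα hr)
  have hρ₂0 : 0 ≤ ρ₄ + 2 * σ := by linarith
  have hρ₂σ : ρ₄ + 2 * σ + σ ≤ (1 - α) * r := by linarith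
  have hρ₂α : ρ₄ + 2 * σ ≤ (1 - α) * r := by linarith
  have hρ₂r : ρ₄ + 2 * σ ≤ r := by linarith
  have hρ₂K : ρ₄ + 2 * σ ≤ δK := by linarith
  have hρ₂0' : ρ₄ + 2 * σ ≤ δ₀ := by linarith
  have hρ₂₃ : ρ₄ + 2 * σ ≤ δ₃ := by linarith
  have hρ₂₃σ : ρ₄ + 2 * σ + σ ≤ δ₃ := by linarith
  set E : (X → ℝ) →ₗ[ℝ] (PX → ℝ) := 𝔭.ΦX U β ∘ₗ Dd U ν with hE
  -- the probe entry Φ^X_β∇_νG₁ : 𝔠^{(0)} → 𝔠_P^{(β−1)} at the rate r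
  have hA := probe43d_cNormR hG hrow hθ hθH hB₀ hBh hr hr0 hrK hK2 he0 (hH0.h43d ν β hβ0 hβ1) (hSD.pXd1 ν β hβ0 hβ1) hfix1 hq
  -- Φ∇_νG₁∇*_μ from `bHX (β+ε)` and Φ∇_νG₁Dv from `bHW (β+ε)` by the right form, into 𝔠_P^{(β)}
  have h45' : HasMaj (bHX (β + ε)) (BlockNorm.ofBlocks (toB6 g R₀ H₀) 𝔭.blkPX) (E ∘ₗ (𝔬.G0 U ∘ₗ Dds U μ))
      (fun (a b : g.Site) => Bi2 ε β * g.len a ^ (-β) * Real.exp (-(δ₀ * g.dist a b))) := hH0.h45m (ν, μ) ε β hε0 hε1 hβ0 hβ1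
  have hGop' := input45_of_step hG hrow hθH hBi2 hCh hΛ hρ₂0 hρ₂σ hρ₂K hρ₂0' hST hA h45' (hSD.tDd1 μ (β + ε) (by linarith)) hfixR
  have hGop : HasMaj (bHX (β + ε)) (cNormR R₀ H₀ 𝔭.blkPX hG.lenle β) (E ∘ₗ (𝔬.G1 U ∘ₗ Dds U μ))
      (fun a b => (Bi2 ε β + (Bh β + θH * (B₀ * (1 - θ * c)⁻¹) * c) * Λ * θH * c) * Real.exp (-((ρ₄ + 2 * σ) * g.dist a b))) :=
    hasMaj_weight_out hG (hGop'.mono fun a b => le_of_eq (by ring))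
  have hε' : 0 < β + ε := by linarith
  have hpd : HasMaj (bHW (β + ε)) (BlockNorm.ofBlocks (toB6 g R₀ H₀) 𝔭.blkPX) (E ∘ₗ (𝔬.G0 U ∘ₗ 𝔬.Dv U))
      (fun (a b : g.Site) => Bd2 ε β * g.len a ^ (-β) * Real.exp (-(δ₃ * g.dist a b))) := hLIM.pdgDvd ν ε β hε0 hε1 hβ0 hβ1
  have hGD' := input45_of_step hG hrow hθv hBd2 hCh hΛ hρ₂0 hρ₂σ hρ₂K hρ₂₃ hST hA hpd (hLIM.tDv (β + ε) hε') hfixR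
  have hGD : HasMaj (bHW (β + ε)) (cNormR R₀ H₀ 𝔭.blkPX hG.lenle β) (E ∘ₗ (𝔬.G1 U ∘ₗ 𝔬.Dv U))
      (fun a b => (Bd2 ε β + (Bh β + θH * (B₀ * (1 - θ * c)⁻¹) * c) * Λ * θv * c) * Real.exp (-((ρ₄ + 2 * σ) * g.dist a b))) :=
    hasMaj_weight_out hG (hGD'.mono fun a b => le_of_eq (by ring))
  -- Φ∇_νG₁Q* : Z^{(0)} → 𝔠_P^{(β−1)} by the left form over the real middle class 𝔠^{(−2)}, then (2.60): 𝔠_Z^{(1)} → 𝔠_P^{(β)}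
  have hGQr : HasMaj (cNormR R₀ H₀ 𝔬.blkZ hG.lenle 0) (cNormR R₀ H₀ 𝔬.blk hG.lenle (-2)) (𝔬.G1 U ∘ₗ 𝔬.Qstar U)
      (fun a b => B₃ * (1 - θ * c)⁻¹ * Real.exp (-(r * g.dist a b))) := by
    have h := hasMaj_toR hG (hasMaj_right_of_step hG hrow hθ hB₃ hr hr₃ hrK hK2 hL.gQs2 hfix1 hq)
    simp only [Nat.cast_zero, neg_zero, Nat.cast_ofNat] at h
    exact h
  have hpQ' : HasMaj (cNormR R₀ H₀ 𝔬.blkZ hG.lenle 0) (cNormR R₀ H₀ 𝔭.blkPX hG.lenle (β - 1)) (E ∘ₗ 𝔬.G0 U ∘ₗ 𝔬.Qstar U)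
      (fun a b => Bq β * Real.exp (-(δ₃ * g.dist a b))) := hLDM.pQd ν β hβ0 hβ1
  have hKE : HasMaj (cNormR R₀ H₀ 𝔬.blk hG.lenle (-2)) (cNormR R₀ H₀ 𝔭.blkPX hG.lenle (β - 1))
      (E ∘ₗ 𝔬.G0 U ∘ₗ (𝔬.Tpi U + 𝔬.T2 U)) (fun a b => θH * Real.exp (-(δK * g.dist a b))) := hSD.pXd1 ν β hβ0 hβ1
  have hDQ := hasMaj_left_rightR hG hrow hθH hBq hA₃ hr hr₃ le_rfl hrK hKE hpQ' hGQr hfix1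
  have hDQT := hasMaj_transfer hG hKQ' hST hDQ
  have e1 : (0 : ℝ) + 1 = 1 := by ring
  have e2 : β - 1 + 1 = β := by ring
  rw [e1, e2] at hDQT
  have hGQ : HasMaj (cNormR R₀ H₀ 𝔬.blkZ hG.lenle 1) (cNormR R₀ H₀ 𝔭.blkPX hG.lenle β) (E ∘ₗ 𝔬.G1 U ∘ₗ 𝔬.Qstar U)
      (fun a b => (Bq β + θH * (B₃ * (1 - θ * c)⁻¹) * c) * Λ * Real.exp (-((ρ₄ + 2 * σ) * g.dist a b))) :=
    hDQT.of_rate_le hG.dnn (mul_nonneg hKQ' hΛ) hρ₂α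
  -- (3.153) in 𝔠_P^{(β)}, then unweighted
  have h := GG_input_of_piecesF hG hrow hc hθ hB₀ hB₃ hBr (add_nonneg hBi2 (mul_nonneg (mul_nonneg (mul_nonneg hCh hΛ) hθH) hc))
    (add_nonneg hBd2 (mul_nonneg (mul_nonneg (mul_nonneg hCh hΛ) hθv) hc)) (mul_nonneg hKQ' hΛ) hσ hρ₄ le_rfl hρ₂r hρ₂₃σ hr hr0 hrK hq
    hK1 (hHR.e2d μ) hL hI (hLIM.domX (β + ε) hε') (hLIM.locX (β + ε) hε') (hLIM.rgdd μ (β + ε) hε') hGop hGD hGQ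
  have hu := hasMaj_unweight_out hG h
  refine hu.mono fun a b => le_of_eq ?_
  simp only [constI45]
  ring

/-- ★ **(3.44) FOR 𝔊 ON THE PACKAGED PAIR FAMILY** — `GG_input44m_of_letters` for every pair, packaged WITHOUT a |P| factor (`hasMaj_familyOp'`: sup sizes):
the family `familyOp (q ↦ ∇_{U,q.1} ∘ 𝔊 ∘ ∇\*_{U,q.2})` read from `bHX ε` into the sharp blocks of X × (P × P) (block map `blk ∘ Prod.fst`) — the input `h44`
of n06-k's `lines3445_of_hasMaj_fam` for 𝔊's kernel family. [cite: Balaban1985BackgroundPropagators, Thm 3.13 p.426 + (3.44) p.398 + (3.39) p.397] -/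
theorem GG_input44Family_of_letters (hG : GeoOK g) (𝔭 : HolderProbes g B X Y PX PY) {𝔬 : Ops g B X Y Z W} {U : B.Cfg}
    {Dd Dds : B.Cfg → P → Module.End ℝ (X → ℝ)}
    {bHX : ℝ → BlockNorm (toB6 g R₀ H₀) (X → ℝ)} {bHW : ℝ → BlockNorm (toB6 g R₀ H₀) (W → ℝ)} {bH : BlockNorm (toB6 g R₀ H₀) (W → ℝ)}
    {Bh Bi Bq Bd : ℝ → ℝ} {Bi2 Bd2 : ℝ → ℝ → ℝ} {θ θD θH θv B₀ B₃ Br δ₀ δ₃ δK r ρ₄ α Λ σ c ε : ℝ} (hrow : RowSum (toB6 g R₀ H₀) σ c)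
    (hc : 0 ≤ c) (hθ : 0 ≤ θ) (hθD : 0 ≤ θD) (hθH : 0 ≤ θH) (hθv : 0 ≤ θv) (hB₀ : 0 ≤ B₀) (hB₃ : 0 ≤ B₃) (hBi : 0 ≤ Bi ε)
    (hBd : 0 ≤ Bd ε) (hBr : 0 ≤ Br) (hΛ : 0 ≤ Λ) (hα : 0 ≤ α) (hσ : 0 ≤ σ) (hε0 : 0 < ε) (hε1 : ε ≤ 1) (hρ₄ : 0 ≤ ρ₄)
    (hρ₄r : ρ₄ + 3 * σ ≤ (1 - α) * r) (hr : 0 ≤ r) (hr0 : r ≤ δ₀) (hr₃ : r ≤ δ₃) (hrK : r + σ ≤ δK) (hq : θ * c < 1)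
    (hST : ScaleTransfer g r α Λ (fun y => g.len y ^ (1 : ℝ)))
    (hK1 : HasMaj (cNorm R₀ H₀ 𝔬.blk hG.lenle 1) (cNorm R₀ H₀ 𝔬.blk hG.lenle 1) (𝔬.G0 U ∘ₗ (𝔬.Tpi U + 𝔬.T2 U))
      (fun a b => θ * Real.exp (-(δK * g.dist a b))))
    (hK2 : HasMaj (cNorm R₀ H₀ 𝔬.blk hG.lenle 2) (cNorm R₀ H₀ 𝔬.blk hG.lenle 2) (𝔬.G0 U ∘ₗ (𝔬.Tpi U + 𝔬.T2 U))
      (fun a b => θ * Real.exp (-(δK * g.dist a b))))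
    (he0 : HasMajorant (g := toB6 g R₀ H₀) 𝔬.blk (𝔬.G0 U) (fun a b => B₀ * g.len a ^ 2 * Real.exp (-(δ₀ * g.dist a b))))
    (hH0 : Thm33G0Dir 𝔬 𝔭 Dd Dds R₀ H₀ bHX B₀ Bh Bi Bi2 δ₀ U) (hHR : Thm33G0DirR 𝔬 Dds R₀ H₀ B₀ δ₀ U)
    (hSD : StepDir 𝔬 𝔭 Dd Dds R₀ H₀ bHX hG.lenle θD θH δK U)
    (hL : Letters313 𝔬 R₀ H₀ hG B₃ δ₃ U) (hLDM : Letters313DM 𝔬 𝔭 Dd R₀ H₀ hG B₃ Bq δ₃ bH U)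
    (hLIM : Letters313IM 𝔬 𝔭 Dd Dds R₀ H₀ hG.lenle bHX bHW Br θv Bd Bd2 δ₃ δK U) (hI : Identities 𝔬 U) :
    HasMaj (bHX ε) (BlockNorm.ofBlocks (toB6 g R₀ H₀) (𝔬.blk ∘ Prod.fst))
      (familyOp (fun q : P × P => Dd U q.1 ∘ₗ (𝔬.GG U ∘ₗ Dds U q.2)))
      (fun (a b : g.Site) => constI44 θ θD θH θv B₀ B₃ (Bi ε) (Bd ε) Br Λ (bHW ε).κ c * Real.exp (-(ρ₄ * g.dist a b))) := by
  have hq1 : 0 ≤ (1 - θ * c)⁻¹ := inv_nonneg.mpr (by linarith)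
  have hK0 : 0 ≤ constI44 θ θD θH θv B₀ B₃ (Bi ε) (Bd ε) Br Λ (bHW ε).κ c := by
    have hκ := (bHW ε).κ_nonneg
    unfold constI44
    positivity
  exact hasMaj_familyOp' (R := R₀) (H := H₀) 𝔬.blk (fun a b => mul_nonneg hK0 (Real.exp_nonneg _))
    fun q => GG_input44m_of_letters hG 𝔭 hrow hc hθ hθD hθH hθv hB₀ hB₃ hBi hBd hBr hΛ hα hσ hε0 hε1 hρ₄ hρ₄r hr hr0 hr₃ hrK hq
      hST hK1 hK2 he0 hH0 hHR hSD hL hLDM hLIM hI q.1 q.2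

/-- ★ **(3.45) FOR 𝔊 ON THE PACKAGED PAIR FAMILY, PROBES SLICED** — `GG_input45m_of_letters` for every pair, the X-probes sliced over the family
(`sliceProbe_comp_familyOp`) and packaged without a |P| factor (`hasMaj_familyOp'`): `sliceProbe Φ^X_β ∘ familyOp (q ↦ ∇_{U,q.1}𝔊∇\*_{U,q.2})` read from
`bHX (β+ε)` into the probe blocks (block map `blkPX ∘ Prod.fst`) — the input `h45` of n06-k's `lines3445_of_hasMaj_fam` for 𝔊's kernel family.
[cite: Balaban1985BackgroundPropagators, Thm 3.13 p.426 + (3.45) p.398 + (3.39)–(3.40) p.397] -/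
theorem GG_input45Family_of_letters (hG : GeoOK g) (𝔭 : HolderProbes g B X Y PX PY) {𝔬 : Ops g B X Y Z W} {U : B.Cfg}
    {Dd Dds : B.Cfg → P → Module.End ℝ (X → ℝ)}
    {bHX : ℝ → BlockNorm (toB6 g R₀ H₀) (X → ℝ)} {bHW : ℝ → BlockNorm (toB6 g R₀ H₀) (W → ℝ)} {bH : BlockNorm (toB6 g R₀ H₀) (W → ℝ)}
    {Bh Bi Bq Bd : ℝ → ℝ} {Bi2 Bd2 : ℝ → ℝ → ℝ} {θ θD θH θv B₀ B₃ Br β δ₀ δ₃ δK r ρ₄ α Λ σ c ε : ℝ}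
    (hrow : RowSum (toB6 g R₀ H₀) σ c)
    (hc : 0 ≤ c) (hθ : 0 ≤ θ) (hθH : 0 ≤ θH) (hθv : 0 ≤ θv) (hB₀ : 0 ≤ B₀) (hB₃ : 0 ≤ B₃) (hBh : 0 ≤ Bh β) (hBi2 : 0 ≤ Bi2 ε β)
    (hBq : 0 ≤ Bq β) (hBd2 : 0 ≤ Bd2 ε β) (hBr : 0 ≤ Br) (hΛ : 0 ≤ Λ) (hα : 0 ≤ α) (hσ : 0 ≤ σ) (hε0 : 0 < ε) (hε1 : ε ≤ 1)
    (hβ0 : 0 ≤ β) (hβ1 : β < 1) (hρ₄ : 0 ≤ ρ₄) (hρ₄r : ρ₄ + 3 * σ ≤ (1 - α) * r) (hr : 0 ≤ r) (hr0 : r ≤ δ₀) (hr₃ : r ≤ δ₃)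
    (hrK : r + σ ≤ δK) (hq : θ * c < 1) (hST : ScaleTransfer g r α Λ (fun y => g.len y ^ (1 : ℝ)))
    (hK1 : HasMaj (cNorm R₀ H₀ 𝔬.blk hG.lenle 1) (cNorm R₀ H₀ 𝔬.blk hG.lenle 1) (𝔬.G0 U ∘ₗ (𝔬.Tpi U + 𝔬.T2 U))
      (fun a b => θ * Real.exp (-(δK * g.dist a b))))
    (hK2 : HasMaj (cNorm R₀ H₀ 𝔬.blk hG.lenle 2) (cNorm R₀ H₀ 𝔬.blk hG.lenle 2) (𝔬.G0 U ∘ₗ (𝔬.Tpi U + 𝔬.T2 U))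
      (fun a b => θ * Real.exp (-(δK * g.dist a b))))
    (he0 : HasMajorant (g := toB6 g R₀ H₀) 𝔬.blk (𝔬.G0 U) (fun a b => B₀ * g.len a ^ 2 * Real.exp (-(δ₀ * g.dist a b))))
    (hH0 : Thm33G0Dir 𝔬 𝔭 Dd Dds R₀ H₀ bHX B₀ Bh Bi Bi2 δ₀ U) (hHR : Thm33G0DirR 𝔬 Dds R₀ H₀ B₀ δ₀ U)
    (hSD : StepDir 𝔬 𝔭 Dd Dds R₀ H₀ bHX hG.lenle θD θH δK U)
    (hL : Letters313 𝔬 R₀ H₀ hG B₃ δ₃ U) (hLDM : Letters313DM 𝔬 𝔭 Dd R₀ H₀ hG B₃ Bq δ₃ bH U)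
    (hLIM : Letters313IM 𝔬 𝔭 Dd Dds R₀ H₀ hG.lenle bHX bHW Br θv Bd Bd2 δ₃ δK U) (hI : Identities 𝔬 U) :
    HasMaj (bHX (β + ε)) (BlockNorm.ofBlocks (toB6 g R₀ H₀) (𝔭.blkPX ∘ Prod.fst))
      (sliceProbe (𝔭.ΦX U β) ∘ₗ familyOp (fun q : P × P => Dd U q.1 ∘ₗ (𝔬.GG U ∘ₗ Dds U q.2)))
      (fun (a b : g.Site) => constI45 θ θH θv B₀ B₃ (Bh β) (Bi2 ε β) (Bd2 ε β) (Bq β) Br Λ (bHW (β + ε)).κ c * g.len a ^ (-β) *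
        Real.exp (-(ρ₄ * g.dist a b))) := by
  have hq1 : 0 ≤ (1 - θ * c)⁻¹ := inv_nonneg.mpr (by linarith)
  have hK0 : 0 ≤ constI45 θ θH θv B₀ B₃ (Bh β) (Bi2 ε β) (Bd2 ε β) (Bq β) Br Λ (bHW (β + ε)).κ c := by
    have hκ := (bHW (β + ε)).κ_nonneg
    unfold constI45
    positivity
  rw [sliceProbe_comp_familyOp]
  refine hasMaj_familyOp' (R := R₀) (H := H₀) 𝔭.blkPX
    (fun a b => mul_nonneg (mul_nonneg hK0 (Real.rpow_nonneg (hG.lenle a) _)) (Real.exp_nonneg _)) fun q => ?_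
  have h := GG_input45m_of_letters hG 𝔭 hrow hc hθ hθH hθv hB₀ hB₃ hBh hBi2 hBq hBd2 hBr hΛ hα hσ hε0 hε1 hβ0 hβ1 hρ₄ hρ₄r hr hr0
    hr₃ hrK hq hST hK1 hK2 he0 hH0 hHR hSD hL hLDM hLIM hI q.1 q.2
  exact h.congr fun μ => rfl

end OneMember

end

end Literature.MathematicalPhysics.QuantumFieldTheory.Balaban1983to89.B9Thm313WholeDirInput
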